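import Mathlib
import HarnessLib
import Summits.CriticalPhenomena.Ising3DConformalLimit.Theses.FKParityRobustness
import Literature.Probability.LatticeModels.LoopO1
import Literature.Probability.LatticeModels.IsingModel
import Literature.Probability.LatticeModels.RandomCluster
import Literature.Probability.Percolation.Percolation

/-!
# Crux `ParityRobustMerging` (stmt-CriticalPhenomena-11253) · idea `pairing-deletion-saturation`
# — DELETION DICTIONARY (no skeleton)

Crux-plan verdict (planner-cruxplan-stmt-CriticalPhenomena-11253-pairing-deletion-sat-0,
2026-08-15): **no-skeleton** — see `Lines/pairing-deletion-saturation.md`. The pairing-deletion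
lever is an exact identity; every inequality it suggests is either the crux / SourceTrailsMeet in
costume (triage r1-1, P3: `Sep − (2/3)·Int ≡ (1/3)·ℓ^A[C]·(3 − 2·Int)`) or collapses to the
`SHUFFLE ∧ RUNG` cut of the line `crossing-order-carrier` (triage P2), where it reappears as a
SHARP-fraction comparison (`(Int − Sep)/Int ≤ (1 − c)/3`). This file therefore registers NO
`stub_*` and NO `ParityRobustMerging_of`; it records, as sorry-free `Prop` definitions over existing
declarations, the identities the lever DOES give (provable now, useful as `--supports` lemmas for
`ParityBound` / `ParityRobustMerging` and as Monte-Carlo decompositions), plus the two scalar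
forms `LoopShadowNonsaturation ≡ SHUFFLE` and `DoubleCurrentRung ≡ RUNG` for the record.

Notation (finite graph `G` on `V`, `β ≥ 0`, `p = fkIsingParam β`, `t = tanh β`,
`a : Fin 4 → V` injective, `A = image a`):
`φ = rcMeasure G p 2 ∅` (free FK-Ising), `ℓ^{ij} = loopO1Measure G t {a i, a j}` (sourced loop
O(1)), `𝒯_S(ω) = tJoins G ω S`, `K_x(F)` = vertex set of the component of `x` in `(V, F)`
(`clusterVerts`), `⟨σ_x σ_y⟩_{V∖K}` = free Ising two-point function of `G` with the vertices `K`
deleted (`depletedTwoPoint`, `0` if `x ∈ K` or `y ∈ K`), `u_a` = parity robustness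
(`parityRobustness`, the route's inlined term), `w_{ij|kl}` = split fraction (`splitFraction`).

* `QuenchedPairingDeletion` (Q): for EVERY configuration `ω`,
  `#{F ∈ 𝒯_A(ω) : F splits A as {a0,a1}|{a2,a3}} = #{F₁ ∈ 𝒯_{01}(ω) : a2 ↔ a3 in ω off K_{a0}(F₁)}`
  (fibrewise over the component `K` of `a0`: `|𝒯_{23}(H)| = 1[a2 ↔_H a3]·|𝒯_∅(H)|` for
  `H = ω off K`, the switching principle quoted in `LoopO1.lean`). Hence, `ω ∈ 𝓕_A`-a.s.,
  `w_{01|23}(ω) = P_{F₁ ~ unif 𝒯_{01}(ω)}[a2 ↔ a3 in ω ∖ K_{a0}(F₁)]` and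
  `u_a = 1 − Σ_π w_π`: parity robustness = the probability that deleting the cluster of a
  UNIFORM T-JOIN OF ONE PAIR separates the other pair, summed over pairings, minus 2.
* `PairingDeletion` (D1, annealed; = (Q) + sourced Grimmett–Janson coupling `ω | F = F ∪ Bern_t`
  both ways + Edwards–Sokal on `G ∖ K`):
  `E_φ[w_{01|23}] = φ[a0 ↔ a1] · E_{ℓ^{01}}[⟨σ_{a2} σ_{a3}⟩_{V ∖ K_{a0}(F)}]`
  (triage r1-1 P3, verified exactly on K4, Q3, 3×3 grid, H-graphs).
* `ParityRobustnessDeletionFormula` (D1 summed): `∫ u_a dφ = ⟨σ_A⟩ − Σ_π φ[π₁ joined]·E_{ℓ^{π₁}}[⟨σ_{π₂}⟩_{V∖K_{π₁}}]`.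
* `FKShadowFormula` (D2; FK domain Markov + Edwards–Sokal):
  `φ[all four joined] = ⟨σ_A⟩ − Σ_π E_φ[1[π₁ joined]·⟨σ_{π₂}⟩_{V ∖ C_{π₁}(ω)}]`.
* `HubCriterion` (Euler + Menger; the qualitative content of `u > 0`): some T-join of `A` in `ω`
  connects `A` iff some vertex `v` has four pairwise EDGE-disjoint `ω`-walks to `a0,…,a3`.
* `LoopShadowNonsaturation` (≡ SHUFFLE, sharp `2/3` form) and `DoubleCurrentRung` (≡ RUNG) in the
  route's frame (box `Λ_N`, tetrahedron `A_l`): recorded, NOT proposed as stubs.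

Scalar dictionary at the symmetric tetrahedron (all `G_{ij}` equal, `GG := G01·G23`,
`Int := −U₄/(2GG) ∈ [0,1]`, `r := φ[J]/GG`, `s := E_φ[u]/GG`, `shadow(S) := 1 − ⟨σ2σ3⟩_{V∖S}/G23`):
`Sep := E_{ℓ^{01}}[shadow K01] = (2Int + s)/3` (D1), `Sh_C := E_φ[shadow C01 | 0↔1] = (2Int + r)/3`
(D2), `Int = E^{01⊗∅}[shadow 𝒞01]` (switching; 𝒞 = double-current cluster), ladder
`K ⊆ 𝒞 ⊆ C ⇒ Sep ≤ Int ≤ Sh_C`; `BLOB ⇔ s ≥ c·r ⇔ Sep − (2/3)Int ≥ c'·Sh_C`;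
`SHUFFLE ⇔ Sep ≥ (2/3 + c)·Int`; `RUNG ⇔ Sh_C ≤ C·Sep`.

Disproof used: none — no `Disproof.lean` is published for this crux yet (`ledger crux ls`,
2026-08-15T23:40Z) and payload.disproof_path is not mounted in this seat.
-/

noncomputable section

namespace Summit.CriticalPhenomena.Ising3DConformalLimit.Cruxes.ParityRobustMerging.PairingDeletionSaturation

open MeasureTheory Finset
open Literature.Probability Literature.Probability.LatticeModels

variable {V : Type*} [Fintype V] [DecidableEq V]

/-- `K_x(F)`: the vertex set of the connected component of `x` in the spanning subgraph `(V, F)`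
(so `x ∈ K_x(F)` always). -/
def clusterVerts (F : Set (Sym2 V)) (x : V) : Finset V :=
  open scoped Classical in
  Finset.univ.filter fun v => (SimpleGraph.fromEdgeSet F).Reachable x v

variable (G : SimpleGraph V) [DecidableRel G.Adj]

/-- The DEPLETED two-point function `⟨σ_x σ_y⟩_{G ∖ K}`: free-boundary Ising two-point function of
`G` in the volume `V ∖ K` (interaction edges = edges of `G` with both ends outside `K`, i.e. the
vertices of `K` deleted), with the convention `0` when `x` or `y` is deleted. By Griffiths II it is
antitone in `K`; by Edwards–Sokal it is the free FK-Ising connection probability `x ↔ y` in `G ∖ K`. -/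
def depletedTwoPoint (β : ℝ) (K : Finset V) (x y : V) : ℝ :=
  if x ∈ K ∨ y ∈ K then 0 else isingTwoPoint G (Finset.univ \ K) β 0 .free x y

/-- Parity robustness `u_a(ω)`: the fraction of T-joins of `A = image a` inside `ω` that keep all
four `a i` in one component (`0/0 = 0`); the route's inlined term written with `tJoins`. -/
def parityRobustness (ω : Set (Sym2 V)) (a : Fin 4 → V) : ℝ :=
  open scoped Classical in
  ((#((tJoins G ω (univ.image a)).filter fun F =>
      ∀ i j, (SimpleGraph.fromEdgeSet (↑F : Set (Sym2 V))).Reachable (a i) (a j))) : ℝ)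
    / (#(tJoins G ω (univ.image a)) : ℝ)

/-- Split fraction `w_{ij|k·}(ω)`: the fraction of T-joins `F` of `A` inside `ω` whose
`F`-component of `a i` contains `a j` but not `a k` (for a T-join this forces the split
`{a i, a j} | {a k, a l}`). `u_a + w_{01|2·} + w_{02|1·} + w_{03|1·} = 1[𝒯_A(ω) ≠ ∅]`. -/
def splitFraction (ω : Set (Sym2 V)) (a : Fin 4 → V) (i j k : Fin 4) : ℝ :=
  open scoped Classical in
  ((#((tJoins G ω (univ.image a)).filter fun F =>
      (SimpleGraph.fromEdgeSet (↑F : Set (Sym2 V))).Reachable (a i) (a j) ∧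
      ¬ (SimpleGraph.fromEdgeSet (↑F : Set (Sym2 V))).Reachable (a i) (a k))) : ℝ)
    / (#(tJoins G ω (univ.image a)) : ℝ)

/-- **(Q) Quenched pairing deletion** — a counting identity valid for every bond configuration:
the T-joins of `A` splitting `A` as `{a0,a1}|{a2,a3}` are equinumerous with the T-joins `F₁` of the
single pair `{a0,a1}` such that `a2` and `a3` are still joined by `ω ∩ E(G)` using only vertices
outside the `F₁`-component of `a0`. (Decompose along the component `K` of `a0`; the fibres are
`𝒯_{23}(ω off K)` and `𝒯_∅(ω off K) × 1[a2 ↔ a3 off K]`, equal by the switching principle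
`|𝓔_S(H)| = 1[H ∈ 𝓕_S]·|𝓔_∅(H)|`, HJK 2025 §2.) Since `|𝒯_A(ω)| = |𝒯_{01}(ω)| = 2^{c(ω)}` when
both are non-empty, this says `w_{01|23}(ω) = P_{F₁ ~ unif 𝒯_{01}(ω)}[a2 ↔ a3 in ω off K_{a0}(F₁)]`.
Provable now (finite combinatorics); size M. -/
def QuenchedPairingDeletion : Prop :=
  ∀ (V : Type) [Fintype V] [DecidableEq V] (G : SimpleGraph V) [DecidableRel G.Adj]
    (ω : Set (Sym2 V)) (a : Fin 4 → V), Function.Injective a →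
    (open scoped Classical in
    #((tJoins G ω (univ.image a)).filter fun F =>
        (SimpleGraph.fromEdgeSet (↑F : Set (Sym2 V))).Reachable (a 0) (a 1) ∧
        ¬ (SimpleGraph.fromEdgeSet (↑F : Set (Sym2 V))).Reachable (a 0) (a 2))
      = #((tJoins G ω {a 0, a 1}).filter fun F₁ =>
          ω ∩ G.edgeSet ∈ Percolation.openConnIn (↑(clusterVerts (↑F₁ : Set (Sym2 V)) (a 0)))ᶜ (a 2) (a 3)))

/-- **(D1) Pairing deletion, annealed** (triage r1-1 P3): for the free FK-Ising measure `φ` of a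
finite graph at `β ≥ 0`,
`E_φ[w_{01|23}] = φ[a0 ↔ a1] · ∫ ⟨σ_{a2} σ_{a3}⟩_{G ∖ K_{a0}(F)} dℓ^{01}(F)`, `ℓ^{01}` the loop O(1)
measure at `t = tanh β` with sources `{a0, a1}`. Inputs: (Q); the sourced Grimmett–Janson coupling
(uniform T-join of `{a0,a1}` in `ω ~ φ[· | a0 ↔ a1]` has law `ℓ^{01}`, and `ω | F = F ∪ Bern_t`);
given `K = K_{a0}(F)` the rest of `F` is `ℓ^∅` on `G ∖ K`, so `ω off K ~ φ_{G∖K}` (unsourced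
Grimmett–Janson); Edwards–Sokal on `G ∖ K`. Provable once the sourced GJ dictionary fact (wanted by
`ParityBound` anyway) is in; size M given that. -/
def PairingDeletion : Prop :=
  ∀ (V : Type) [Fintype V] [DecidableEq V] (G : SimpleGraph V) [DecidableRel G.Adj] (β : ℝ),
    0 ≤ β → ∀ a : Fin 4 → V, Function.Injective a →
    (let φ := rcMeasure G (fkIsingParam β) 2 ∅
     let ℓ01 := loopO1Measure G (Real.tanh β) {a 0, a 1}
     ∫ ω, splitFraction G ω a 0 1 2 ∂φ
       = φ.real (Percolation.openConn (a 0) (a 1))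
         * ∫ F, depletedTwoPoint G β (clusterVerts F (a 0)) (a 2) (a 3) ∂ℓ01)

/-- **(D1, summed) Parity robustness by deletion**: `∫ u_a dφ = ⟨σ_A⟩^free_G −
Σ_{π ∈ {01|23, 02|13, 03|12}} φ[π₁ joined] · E_{ℓ^{π₁}}[⟨σ_{π₂}⟩_{G ∖ K_{π₁}}]`
(sum rule `u + Σ_π w_π = 1[ω ∈ 𝓕_A]`, Edwards–Sokal `φ[𝓕_A] = ⟨σ_A⟩^free`, and (D1) for each
pairing). At the symmetric tetrahedron the three subtracted terms are equal (the 24 symmetries of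
`(Λ_N, A_l)` act on the pairings as `S₄ ↠ S₃`). -/
def ParityRobustnessDeletionFormula : Prop :=
  ∀ (V : Type) [Fintype V] [DecidableEq V] (G : SimpleGraph V) [DecidableRel G.Adj] (β : ℝ),
    0 ≤ β → ∀ a : Fin 4 → V, Function.Injective a →
    (let φ := rcMeasure G (fkIsingParam β) 2 ∅
     let t := Real.tanh β
     let term : Fin 4 → Fin 4 → Fin 4 → Fin 4 → ℝ := fun i j k l =>
       φ.real (Percolation.openConn (a i) (a j))
         * ∫ F, depletedTwoPoint G β (clusterVerts F (a i)) (a k) (a l) ∂(loopO1Measure G t {a i, a j})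
     ∫ ω, parityRobustness G ω a ∂φ
       = isingCorr G Finset.univ β 0 .free (univ.image a) - (term 0 1 2 3 + term 0 2 1 3 + term 0 3 1 2))

/-- **(D2) FK shadow formula** (domain Markov property of the free random-cluster measure +
Edwards–Sokal on the depleted graph): `φ[all four joined] = ⟨σ_A⟩^free_G −
Σ_π E_φ[1[π₁ joined in ω] · ⟨σ_{π₂}⟩_{G ∖ C_{π₁}(ω)}]`, `C_{π₁}(ω)` the `ω`-cluster of the pair `π₁`
(`φ[𝓕_A] = φ[J] + Σ_π φ[D_π]` and `φ[D_π] = E_φ[1[π₁ joined]·φ_{G∖V(C_{π₁})}[π₂ joined]]`).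
Provable now from `RandomClusterDomainMarkov` + `edwardsSokal_twoPoint`; size M. With (D1):
`E_φ[1_J − u_a] = Σ_π φ[π₁ joined]·E_coupling[⟨σ_{π₂}⟩_{G∖K_{π₁}} − ⟨σ_{π₂}⟩_{G∖C_{π₁}}] ≥ 0`
termwise (`K ⊆ C` in the Grimmett–Janson coupling, Griffiths II), i.e. the parity-fragile mass is
the K-versus-C SHADOW DEFICIT. -/
def FKShadowFormula : Prop :=
  ∀ (V : Type) [Fintype V] [DecidableEq V] (G : SimpleGraph V) [DecidableRel G.Adj] (β : ℝ),
    0 ≤ β → ∀ a : Fin 4 → V, Function.Injective a →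
    (open scoped Classical in
     let φ := rcMeasure G (fkIsingParam β) 2 ∅
     let term : Fin 4 → Fin 4 → Fin 4 → Fin 4 → ℝ := fun i j k l =>
       ∫ ω, (if (Percolation.openGraph ω).Reachable (a i) (a j)
              then depletedTwoPoint G β (clusterVerts ω (a i)) (a k) (a l) else 0) ∂φ
     φ.real {ω | ∀ i j, (Percolation.openGraph ω).Reachable (a i) (a j)}
       = isingCorr G Finset.univ β 0 .free (univ.image a) - (term 0 1 2 3 + term 0 2 1 3 + term 0 3 1 2))

/-- **Hub criterion** (Euler trail decomposition + edge-Menger; the qualitative content of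
`u_a(ω) > 0`, the route's foreseen `XJoinExists`): some T-join of `A` inside `ω` keeps `A` in one
component iff some vertex `v` (possibly one of the `a i`) is joined to `a 0, …, a 3` by four
pairwise EDGE-disjoint walks of `ω ∩ E(G)`. (⇐: reduce the walks to paths and take their union —
degrees are odd exactly on `A`; ⇒: the `A`-component of a connected T-join is a connected graph
with odd set `A`, hence the union of two edge-disjoint trails pairing `A`, which share a vertex.)
In the deletion picture: if NO pairing of the four ports admits two VERTEX-disjoint realising
paths then every `w_π(ω) = 0` and `u_a(ω) = 1` (star / cut-vertex junctions); `u_a(ω) = 0` iff no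
hub (2|2 bridges, re-pairing rings). Provable now; size M (Mathlib has Eulerian trails for ≤ 2 odd
vertices only). -/
def HubCriterion : Prop :=
  ∀ (V : Type) [Fintype V] [DecidableEq V] (G : SimpleGraph V) [DecidableRel G.Adj]
    (ω : Set (Sym2 V)) (a : Fin 4 → V), Function.Injective a →
    ((∃ F ∈ tJoins G ω (univ.image a),
        ∀ i j, (SimpleGraph.fromEdgeSet (↑F : Set (Sym2 V))).Reachable (a i) (a j)) ↔
      ∃ (v : V) (p : (i : Fin 4) → (Percolation.openGraph (ω ∩ G.edgeSet)).Walk v (a i)),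
        ∀ i j, i ≠ j → List.Disjoint (p i).edges (p j).edges)

/-! ### The two scalar forms in the route's frame (recorded, not proposed as stubs)

Frame copied from `FKParityRobustness.ParityRobustMerging`: `Λ_N = box 3 N` with its induced
nearest-neighbour graph, `φ_N` the free FK-Ising measure at `β_c(3)`, `a = l • tetra`. -/

/-- **LoopShadowNonsaturation ≡ SHUFFLE** (triage P1–P3; sharp-`2/3` form, NOT a stub): in the
route's frame, `Σ_π G_{π₁}·(G_{π₂} − E_{ℓ^{π₁}}[⟨σ_{π₂}⟩_{Λ_N ∖ K_{π₁}}]) ≥ (1 + c)·(Σ_π G_{π₁}G_{π₂} − ⟨σ_A⟩)`: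
the total pair shadow exceeds the Lebowitz deficit `|U₄|` by a fixed FACTOR. By (D1, summed) the
left side minus `|U₄|` is exactly `∫ u_a dφ_N ≥ 0`, so this is `∫ u_a dφ_N ≥ c·|U₄^free_{Λ_N}(a)|`,
i.e. `SHUFFLE` of the line `crossing-order-carrier` (`E^{01⊗23}[u_A(trace(n₁+n₂)) | traces
co-joined] ≥ 2c`) verbatim up to the carrier-switching identity; at the tetrahedron it reads
`Sep ≥ (2/3)(1 + c)·Int`, a sharp-fraction comparison — the reason this idea yields no skeleton of
its own. Here `G_{ij} = ⟨σ_{a i}σ_{a j}⟩^free_{Λ_N}` is written as `depletedTwoPoint … ∅`. -/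
def LoopShadowNonsaturation : Prop :=
  let tetra : Fin 4 → Site 3 := ![![-1, -1, -1], ![1, 1, -1], ![1, -1, 1], ![-1, 1, 1]]
  ∃ c : ℝ, 0 < c ∧ ∀ l : ℕ, 1 ≤ l → ∃ N₀ : ℕ, ∀ N : ℕ, N₀ ≤ N → ∀ a : Fin 4 → ↥(box 3 N),
    (∀ i, ((a i : Site 3)) = (l : ℤ) • tetra i) →
    (let Gr := (zdGraph 3).comap (Subtype.val : ↥(box 3 N) → Site 3)
     let β := criticalBeta 3
     let two : Fin 4 → Fin 4 → ℝ := fun i j => depletedTwoPoint Gr β ∅ (a i) (a j)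
     let dep : Fin 4 → Fin 4 → Fin 4 → Fin 4 → ℝ := fun i j k l =>
       ∫ F, depletedTwoPoint Gr β (clusterVerts F (a i)) (a k) (a l) ∂(loopO1Measure Gr (Real.tanh β) {a i, a j})
     let shadowSum := two 0 1 * (two 2 3 - dep 0 1 2 3) + two 0 2 * (two 1 3 - dep 0 2 1 3)
       + two 0 3 * (two 1 2 - dep 0 3 1 2)
     let lebowitzDeficit := two 0 1 * two 2 3 + two 0 2 * two 1 3 + two 0 3 * two 1 2
       - isingCorr Gr Finset.univ β 0 .free (univ.image a)
     (1 + c) * lebowitzDeficit ≤ shadowSum)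

/-- **DoubleCurrentRung ≡ RUNG** (triage P2; NOT a stub here): in the route's frame,
`c·φ_N[all four joined] ≤ (Σ_π G_{π₁}G_{π₂} − ⟨σ_A⟩)/2 = |U₄^free_{Λ_N}(a)|/2 = G01·G23·Int` — the
double-current rung is at least a constant times the FK rung. Necessary for BLOB (`u_a ≤ 1_J` and
`|U₄| ≤ 2φ[J]` give the converse direction for free), implied by the lattice clause (iii) `INT`
(which must stay an OUTPUT of the route), and `BLOB ⇔ LoopShadowNonsaturation ∧ DoubleCurrentRung`
exactly. In shadow coordinates `RUNG ⇔ Sh_C ≤ C·Sep` (FK-cluster shadow at most a constant times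
the loop-cluster shadow). -/
def DoubleCurrentRung : Prop :=
  let tetra : Fin 4 → Site 3 := ![![-1, -1, -1], ![1, 1, -1], ![1, -1, 1], ![-1, 1, 1]]
  ∃ c : ℝ, 0 < c ∧ ∀ l : ℕ, 1 ≤ l → ∃ N₀ : ℕ, ∀ N : ℕ, N₀ ≤ N → ∀ a : Fin 4 → ↥(box 3 N),
    (∀ i, ((a i : Site 3)) = (l : ℤ) • tetra i) →
    (let Gr := (zdGraph 3).comap (Subtype.val : ↥(box 3 N) → Site 3)
     let β := criticalBeta 3
     let φ := rcMeasure Gr (fkIsingParam β) 2 ∅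
     let two : Fin 4 → Fin 4 → ℝ := fun i j => depletedTwoPoint Gr β ∅ (a i) (a j)
     let lebowitzDeficit := two 0 1 * two 2 3 + two 0 2 * two 1 3 + two 0 3 * two 1 2
       - isingCorr Gr Finset.univ β 0 .free (univ.image a)
     c * φ.real {ω | ∀ i j, (Percolation.openGraph ω).Reachable (a i) (a j)} ≤ lebowitzDeficit / 2)

/-- Sanity link to the crux BY NAME: the decl this dictionary is about (no `_of` theorem is
offered — see the module docstring). -/
example : Prop := Summit.CriticalPhenomena.Ising3DConformalLimit.Theses.FKParityRobustness.ParityRobustMerging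

end Summit.CriticalPhenomena.Ising3DConformalLimit.Cruxes.ParityRobustMerging.PairingDeletionSaturation

end
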